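import Summits.HodgeConjecture.HodgeConjecture.Theorems.K2E5QuatZetaAbsConv   -- ★ (g) p855899: brings ★ (β)∕(γ) (`exists_isCompact_forall_mul_mem`, ★ A7 `fiberLIntegral_count_mk`, ★ `lintegral_fiberLIntegral_quotientMeasure`), ★ G1′, ★ `K2E5QuatThetaBounds.thetaTail_le_exp`
import HarnessLib

/-!
# K2 ∕ E5 «TamagawaUnitary» — tier-2 file `K2E5QuatZetaPlusBound`: layer (R2) of the G3 residue — the inner integral decays like `e^{−2t}`

Track B «K2-LIT», engine E5, crux H413 (`stmt-HodgeConjecture-24833`); seat K2E5-p07 (g0), G3 RESIDUE LEAD (K2E5-plan (g2) SWEEP #12b (26)).  Pays the part `hplus` of ★ (R0)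
`K2E5QuatZetaResidueOfParts.quatZetaResidue_of_parts` BY ITS BYTES:
* §1 `lintegral_unitsOne_le_covol_mul` — WEIL'S CONSTANT-ONE UNFOLDING OVER `Γ_h` AS AN INEQUALITY: if the `Γ_h`-sums of a Borel `φ ≥ 0` along `y ↦ y·θ` are `≤ b` on a set
  `K ⊆ D^{(1)}_{h,𝔸}` meeting every `Γ_h`-coset, then `∫_{D^{(1)}} φ(yθ) dx¹(y) ≤ covol(D^{(1)} ∕ Γ_h, dx¹) · b` (★ `lintegral_fiberLIntegral_quotientMeasure`, ★ A7
  `fiberLIntegral_count_mk`, `Γ_h`-periodicity by reindexing) — the (β) step as a reusable organ (R4 uses it too);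
* §2 `norm_inner_le_exp` (= `hplus`, indeed for EVERY real `t`): `‖∫ Φ(y θ_{e^t}) dx¹(y)‖ ≤ B · e^{−2t}` with `B = covol · B₂`, `B₂` the constant of ★ K2E5-p01's
  `thetaTail_le_exp` at rate `κ = 2` on the compact covering set supplied by FUJISAKI ★ G1′ (`K2E5QuatUnitsOneCocompact.quatUnitsOneCocompact`, K2E5-p03) through ★ (γ)
  `exists_isCompact_forall_mul_mem`; `norm_inner_le_exp_two` restates it in the exact `∃ B, ∀ t, 0 < t → …` bytes of ★ (R0).
No `sorry`, no `instance`, no `notation`, axioms ⊆ the trio.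

HONEST LABEL: HC_CM is proved only modulo the 7 printed citations (2 remaining named inputs: hLiu418 = stmt-HodgeConjecture-24832, h413 = stmt-HodgeConjecture-24833) until rung 0
closes; this file is a helper (`--supports stmt-HodgeConjecture-24833 --as helper`) and changes no count.

## References
[WeilBNT1967] A. Weil, *Basic Number Theory* (1967), Ch. VII §5 Prop. 11, §6 · [VignerasLNM800] M.-F. Vignéras, LNM 800 (1980), Ch. III §2 Thm. 2.2 · [TateThesis1967] J. Tate,
in Cassels–Fröhlich (1967), Ch. XV §4.4.
-/

set_option autoImplicit false
set_option linter.dupNamespace false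

noncomputable section

namespace Summit.HodgeConjecture.HodgeConjecture.Cruxes.H413.K2E5QuatZetaPlusBound

open NumberField IsDedekindDomain MeasureTheory MeasureTheory.Measure Filter Topology Set
open scoped Matrix MatrixGroups NNReal ENNReal
open Literature.MeasureTheory.Group Literature.NumberTheory Literature.NumberTheory.Automorphic
open Literature.AlgebraicGeometry.ShimuraVarieties (hermForm)
open Summit.HodgeConjecture.HodgeConjecture.Cruxes.H413.K2E5QuatAdelicMatrixModel
open Summit.HodgeConjecture.HodgeConjecture.Cruxes.H413.K2E5QuatZeta
open Summit.HodgeConjecture.HodgeConjecture.Cruxes.H413.K2E5QuatAdelicLattice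
open Summit.HodgeConjecture.HodgeConjecture.Cruxes.H413.K2E5QuatAdelicModuleOne
open Summit.HodgeConjecture.HodgeConjecture.Cruxes.H413.K2E5QuatZetaAbsConvReduction
open Summit.HodgeConjecture.HodgeConjecture.Cruxes.H413.K2E5QuatZetaAbsConvOfThetaBounds

section Core

set_option synthInstance.maxHeartbeats 400000
set_option maxHeartbeats 1600000

variable (L : Type) [Field L] [NumberField L] [IsCMField L] {Ha : Matrix (Fin 2) (Fin 2) L}
  [MeasurableSpace (GL (Fin 2) (AdeleRing (𝓞 L) L))] [BorelSpace (GL (Fin 2) (AdeleRing (𝓞 L) L))]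
  [MeasurableSpace (↥(quatAdelicUnitsOne L Ha) ⧸ quatRatLatticeOne L Ha)] [BorelSpace (↥(quatAdelicUnitsOne L Ha) ⧸ quatRatLatticeOne L Ha)]
  [LocallyCompactSpace ↥(quatAdelicUnitsOne L Ha)] [SecondCountableTopology ↥(quatAdelicUnitsOne L Ha)] [T2Space ↥(quatAdelicUnitsOne L Ha)]

/-! ## §1 Weil's constant-one unfolding over `Γ_h` as an inequality -/

/-- **UNFOLDING INEQUALITY**: if `Σ_{γ ∈ Γ_h} φ(y γ θ) ≤ b` for all `y` in a set `K` meeting every `Γ_h`-coset, then `∫_{D^{(1)}_{h,𝔸}} φ(y θ) dx¹(y) ≤ covol(D^{(1)} ∕ Γ_h, dx¹) · b`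
(Weil's formula with constant one, ★ `lintegral_fiberLIntegral_quotientMeasure`; the fibre integrals against `count` are the `Γ_h`-sums, ★ A7 `fiberLIntegral_count_mk`; `Γ_h`-periodicity
moves every coset representative into `K`). [cite: WeilBNT1967, Ch. VII §6] [cite: VignerasLNM800, Ch. III §2] -/
theorem lintegral_unitsOne_le_covol_mul (Ha : Matrix (Fin 2) (Fin 2) L)
    [MeasurableSpace (↥(quatAdelicUnitsOne L Ha) ⧸ quatRatLatticeOne L Ha)] [BorelSpace (↥(quatAdelicUnitsOne L Ha) ⧸ quatRatLatticeOne L Ha)]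
    [LocallyCompactSpace ↥(quatAdelicUnitsOne L Ha)] [SecondCountableTopology ↥(quatAdelicUnitsOne L Ha)] [T2Space ↥(quatAdelicUnitsOne L Ha)]
    (dx1 : Measure ↥(quatAdelicUnitsOne L Ha)) [dx1.IsHaarMeasure] [dx1.IsMulRightInvariant]
    [(count : Measure ↥(quatRatLatticeOne L Ha)).IsHaarMeasure]
    (K : Set ↥(quatAdelicUnitsOne L Ha)) (hK : ∀ y : ↥(quatAdelicUnitsOne L Ha), ∃ γ : ↥(quatRatLatticeOne L Ha), y * γ ∈ K)
    {φ : ↥(quatAdelicUnits L Ha) → ℝ≥0∞} (hφ : Measurable φ) (θ : ↥(quatAdelicUnits L Ha)) {b : ℝ≥0∞}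
    (hb : ∀ y ∈ K, (∑' γ : ↥(quatRatLatticeOne L Ha), φ (((y * γ : ↥(quatAdelicUnitsOne L Ha)) : ↥(quatAdelicUnits L Ha)) * θ)) ≤ b) :
    ∫⁻ y, φ ((y : ↥(quatAdelicUnits L Ha)) * θ) ∂dx1 ≤
      quotientMeasure (quatRatLatticeOne L Ha) (count : Measure ↥(quatRatLatticeOne L Ha)) (isClosed_quatRatLatticeOne L Ha) dx1 Set.univ * b := by
  haveI : IsClosed ((quatRatLatticeOne L Ha : Subgroup ↥(quatAdelicUnitsOne L Ha)) : Set ↥(quatAdelicUnitsOne L Ha)) := isClosed_quatRatLatticeOne L Ha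
  haveI : Countable ↥(quatRatLatticeOne L Ha) := countable_quatRatLatticeOne L Ha
  haveI : DiscreteTopology ↥(quatRatLatticeOne L Ha) := discreteTopology_quatRatLatticeOne L Ha
  haveI : MeasurableSingletonClass ↥(quatRatLatticeOne L Ha) := by
    haveI : T2Space ↥(quatRatLatticeOne L Ha) := inferInstance
    infer_instance
  -- the fibre sums are bounded by `b` at EVERY point (periodicity + the covering set `K`)
  have hfib : ∀ y : ↥(quatAdelicUnitsOne L Ha),
      fiberLIntegral (quatRatLatticeOne L Ha) (count : Measure ↥(quatRatLatticeOne L Ha))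
        (fun y : ↥(quatAdelicUnitsOne L Ha) => φ ((y : ↥(quatAdelicUnits L Ha)) * θ)) (QuotientGroup.mk y) ≤ b := by
    intro y
    obtain ⟨γ₀, hγ₀⟩ := hK y
    rw [K2E5HaarCovolTower.fiberLIntegral_count_mk]
    have hre : (∑' γ : ↥(quatRatLatticeOne L Ha), φ (((y * γ : ↥(quatAdelicUnitsOne L Ha)) : ↥(quatAdelicUnits L Ha)) * θ)) =
        ∑' γ : ↥(quatRatLatticeOne L Ha), φ ((((y * γ₀) * γ : ↥(quatAdelicUnitsOne L Ha)) : ↥(quatAdelicUnits L Ha)) * θ) := by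
      rw [← (Equiv.mulLeft γ₀).tsum_eq]
      refine tsum_congr fun γ => ?_
      simp only [Equiv.coe_mulLeft, Subgroup.coe_mul, mul_assoc]
    rw [hre]
    exact hb (y * γ₀) hγ₀
  have hmeas : Measurable fun y : ↥(quatAdelicUnitsOne L Ha) => φ ((y : ↥(quatAdelicUnits L Ha)) * θ) :=
    hφ.comp (continuous_subtype_val.mul continuous_const).measurable
  rw [← lintegral_fiberLIntegral_quotientMeasure (quatRatLatticeOne L Ha) (count : Measure ↥(quatRatLatticeOne L Ha)) dx1 hmeas]
  calc ∫⁻ q, fiberLIntegral (quatRatLatticeOne L Ha) (count : Measure ↥(quatRatLatticeOne L Ha))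
          (fun y : ↥(quatAdelicUnitsOne L Ha) => φ ((y : ↥(quatAdelicUnits L Ha)) * θ)) q
        ∂quotientMeasure (quatRatLatticeOne L Ha) (count : Measure ↥(quatRatLatticeOne L Ha)) (isClosed_quatRatLatticeOne L Ha) dx1
      ≤ ∫⁻ _, b ∂quotientMeasure (quatRatLatticeOne L Ha) (count : Measure ↥(quatRatLatticeOne L Ha)) (isClosed_quatRatLatticeOne L Ha) dx1 := by
        refine lintegral_mono fun q => ?_
        induction q using QuotientGroup.induction_on with
        | H y => exact hfib y
    _ = _ := by rw [lintegral_const, mul_comm]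

/-! ## §2 The part `hplus` of ★ (R0): `‖I(t)‖ ≤ B e^{−2t}` -/

variable (hHa : (Ha.map (cmConjRingHom L)).transpose = Ha) (hdet : Ha.det ≠ 0)

/-- **`‖∫ Φ(y θ_{e^t}) dx¹(y)‖ ≤ B · e^{−2t}` FOR EVERY REAL `t`** (`h` anisotropic): unfolding inequality §1 with `φ = ‖Φ‖ₑ`, the compact covering set of Fujisaki ★ G1′ and ★
K2E5-p01's `thetaTail_le_exp` at rate `2`; `B = covol(D^{(1)} ∕ Γ_h, dx¹) · B₂ < ∞`. [cite: WeilBNT1967, Ch. VII §5 Prop. 11] [cite: VignerasLNM800, Ch. III §2 Thm. 2.2] -/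
theorem norm_inner_le_exp (hanis : ∀ x : Fin 2 → L, hermForm (cmConjRingHom L) Ha x x = 0 → x = 0)
    (dx1 : Measure ↥(quatAdelicUnitsOne L Ha)) [dx1.IsHaarMeasure] [dx1.IsMulRightInvariant]
    [(count : Measure ↥(quatRatLatticeOne L Ha)).IsHaarMeasure]
    {Φ : Matrix (Fin 2) (Fin 2) (AdeleRing (𝓞 L) L) → ℂ}
    (hΦ : Φ ∈ quatSchwartzBruhat L (fun i => ((quatBasis L Ha hHa hdet i : ↥(quatRatSubalgebra L Ha)) : Matrix (Fin 2) (Fin 2) L))) :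
    ∃ B : ℝ, ∀ t : ℝ, ‖∫ y : ↥(quatAdelicUnitsOne L Ha), Φ ((((y : ↥(quatAdelicUnits L Ha)) *
        quatModuleSection L Ha (Units.mk0 (Real.toNNReal (Real.exp t)) (Real.toNNReal_pos.2 (Real.exp_pos t)).ne') : ↥(quatAdelicUnits L Ha)) :
          GL (Fin 2) (AdeleRing (𝓞 L) L)) : Matrix (Fin 2) (Fin 2) (AdeleRing (𝓞 L) L)) ∂dx1‖ ≤ B * Real.exp (-2 * t) := by
  haveI : CompactSpace (↥(quatAdelicUnitsOne L Ha) ⧸ quatRatLatticeOne L Ha) := K2E5QuatUnitsOneCocompact.quatUnitsOneCocompact L Ha hHa hanis hdet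
  haveI : IsClosed ((quatRatLatticeOne L Ha : Subgroup ↥(quatAdelicUnitsOne L Ha)) : Set ↥(quatAdelicUnitsOne L Ha)) := isClosed_quatRatLatticeOne L Ha
  obtain ⟨K, hKc, hK⟩ := exists_isCompact_forall_mul_mem (quatRatLatticeOne L Ha)
  obtain ⟨B, hB, hb⟩ := K2E5QuatThetaBounds.thetaTail_le_exp L hHa hdet hKc hΦ (κ := 2) (by norm_num)
  set V : ℝ≥0∞ := quotientMeasure (quatRatLatticeOne L Ha) (count : Measure ↥(quatRatLatticeOne L Ha)) (isClosed_quatRatLatticeOne L Ha) dx1 Set.univ with hV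
  have hVt : V < ⊤ := isCompact_univ.measure_lt_top
  have hφ : Measurable fun x : ↥(quatAdelicUnits L Ha) => ‖Φ ((x : GL (Fin 2) (AdeleRing (𝓞 L) L)) : Matrix (Fin 2) (Fin 2) (AdeleRing (𝓞 L) L))‖ₑ :=
    (continuous_testFunction_restrict L hHa hdet hΦ).enorm.measurable
  refine ⟨(V * B).toReal, fun t => ?_⟩
  have hle := lintegral_unitsOne_le_covol_mul L Ha dx1 K hK hφ
    (quatModuleSection L Ha (Units.mk0 (Real.toNNReal (Real.exp t)) (Real.toNNReal_pos.2 (Real.exp_pos t)).ne')) (fun y hy => hb y hy t)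
  calc ‖∫ y : ↥(quatAdelicUnitsOne L Ha), Φ ((((y : ↥(quatAdelicUnits L Ha)) *
          quatModuleSection L Ha (Units.mk0 (Real.toNNReal (Real.exp t)) (Real.toNNReal_pos.2 (Real.exp_pos t)).ne') : ↥(quatAdelicUnits L Ha)) :
            GL (Fin 2) (AdeleRing (𝓞 L) L)) : Matrix (Fin 2) (Fin 2) (AdeleRing (𝓞 L) L)) ∂dx1‖
      ≤ (∫⁻ y : ↥(quatAdelicUnitsOne L Ha), ‖Φ ((((y : ↥(quatAdelicUnits L Ha)) *
          quatModuleSection L Ha (Units.mk0 (Real.toNNReal (Real.exp t)) (Real.toNNReal_pos.2 (Real.exp_pos t)).ne') : ↥(quatAdelicUnits L Ha)) :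
            GL (Fin 2) (AdeleRing (𝓞 L) L)) : Matrix (Fin 2) (Fin 2) (AdeleRing (𝓞 L) L))‖ₑ ∂dx1).toReal := by
        refine (norm_integral_le_lintegral_norm _).trans_eq ?_
        simp only [ofReal_norm]
    _ ≤ (V * (B * ENNReal.ofReal (Real.exp (-2 * t)))).toReal :=
        ENNReal.toReal_mono (ENNReal.mul_ne_top hVt.ne (ENNReal.mul_ne_top hB ENNReal.ofReal_ne_top)) hle
    _ = (V * B).toReal * Real.exp (-2 * t) := by
        rw [← mul_assoc, ENNReal.toReal_mul, ENNReal.toReal_ofReal (Real.exp_nonneg _)]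

/-- **PART `hplus` OF ★ (R0), token for token**: `∃ B, ∀ t > 0, ‖∫ Φ(y θ_{e^t}) dx¹(y)‖ ≤ B · e^{−2t}`. [cite: WeilBNT1967, Ch. VII §5 Prop. 11] -/
theorem norm_inner_le_exp_two (hanis : ∀ x : Fin 2 → L, hermForm (cmConjRingHom L) Ha x x = 0 → x = 0)
    (dx1 : Measure ↥(quatAdelicUnitsOne L Ha)) [dx1.IsHaarMeasure] [dx1.IsMulRightInvariant]
    [(count : Measure ↥(quatRatLatticeOne L Ha)).IsHaarMeasure]
    {Φ : Matrix (Fin 2) (Fin 2) (AdeleRing (𝓞 L) L) → ℂ}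
    (hΦ : Φ ∈ quatSchwartzBruhat L (fun i => ((quatBasis L Ha hHa hdet i : ↥(quatRatSubalgebra L Ha)) : Matrix (Fin 2) (Fin 2) L))) :
    ∃ B : ℝ, ∀ t : ℝ, 0 < t → ‖∫ y : ↥(quatAdelicUnitsOne L Ha), Φ ((((y : ↥(quatAdelicUnits L Ha)) *
        quatModuleSection L Ha (Units.mk0 (Real.toNNReal (Real.exp t)) (Real.toNNReal_pos.2 (Real.exp_pos t)).ne') : ↥(quatAdelicUnits L Ha)) :
          GL (Fin 2) (AdeleRing (𝓞 L) L)) : Matrix (Fin 2) (Fin 2) (AdeleRing (𝓞 L) L)) ∂dx1‖ ≤ B * Real.exp (-2 * t) := by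
  obtain ⟨B, hB⟩ := norm_inner_le_exp L hHa hdet hanis dx1 hΦ
  exact ⟨B, fun t _ => hB t⟩

/-! ## §3 (ED. 2, for R4's unfoldings) `∫⁻ ‖Φ(y θ_{e^t})‖ dx¹ ≤ B e^{−2t}` and integrability of `y ↦ Φ(y θ_{e^t})` on `D^{(1)}_{h,𝔸}` -/

/-- **`∫⁻_{D^{(1)}} ‖Φ(y θ_{e^t})‖ₑ dx¹(y) ≤ B · e^{−2t}` for every real `t`**, `B = covol · B₂ ≠ ⊤` (§1 with `φ = ‖Φ‖ₑ`, Fujisaki ★ G1′, ★ `thetaTail_le_exp` at rate 2) — the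
`ℝ≥0∞` form of `norm_inner_le_exp`, which R4 (K2E5-p14) consumes for `Φ` and for `Φ̂`. [cite: WeilBNT1967, Ch. VII §5 Prop. 11] [cite: VignerasLNM800, Ch. III §2 Thm. 2.2] -/
theorem lintegral_inner_enorm_le_exp (hanis : ∀ x : Fin 2 → L, hermForm (cmConjRingHom L) Ha x x = 0 → x = 0)
    (dx1 : Measure ↥(quatAdelicUnitsOne L Ha)) [dx1.IsHaarMeasure] [dx1.IsMulRightInvariant]
    [(count : Measure ↥(quatRatLatticeOne L Ha)).IsHaarMeasure]
    {Φ : Matrix (Fin 2) (Fin 2) (AdeleRing (𝓞 L) L) → ℂ}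
    (hΦ : Φ ∈ quatSchwartzBruhat L (fun i => ((quatBasis L Ha hHa hdet i : ↥(quatRatSubalgebra L Ha)) : Matrix (Fin 2) (Fin 2) L))) :
    ∃ B : ℝ≥0∞, B ≠ ⊤ ∧ ∀ t : ℝ, ∫⁻ y : ↥(quatAdelicUnitsOne L Ha), ‖Φ ((((y : ↥(quatAdelicUnits L Ha)) *
        quatModuleSection L Ha (Units.mk0 (Real.toNNReal (Real.exp t)) (Real.toNNReal_pos.2 (Real.exp_pos t)).ne') : ↥(quatAdelicUnits L Ha)) :
          GL (Fin 2) (AdeleRing (𝓞 L) L)) : Matrix (Fin 2) (Fin 2) (AdeleRing (𝓞 L) L))‖ₑ ∂dx1 ≤ B * ENNReal.ofReal (Real.exp (-2 * t)) := by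
  haveI : CompactSpace (↥(quatAdelicUnitsOne L Ha) ⧸ quatRatLatticeOne L Ha) := K2E5QuatUnitsOneCocompact.quatUnitsOneCocompact L Ha hHa hanis hdet
  haveI : IsClosed ((quatRatLatticeOne L Ha : Subgroup ↥(quatAdelicUnitsOne L Ha)) : Set ↥(quatAdelicUnitsOne L Ha)) := isClosed_quatRatLatticeOne L Ha
  obtain ⟨K, hKc, hK⟩ := exists_isCompact_forall_mul_mem (quatRatLatticeOne L Ha)
  obtain ⟨B, hB, hb⟩ := K2E5QuatThetaBounds.thetaTail_le_exp L hHa hdet hKc hΦ (κ := 2) (by norm_num)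
  have hVt : quotientMeasure (quatRatLatticeOne L Ha) (count : Measure ↥(quatRatLatticeOne L Ha)) (isClosed_quatRatLatticeOne L Ha) dx1 Set.univ < ⊤ :=
    isCompact_univ.measure_lt_top
  have hφ : Measurable fun x : ↥(quatAdelicUnits L Ha) => ‖Φ ((x : GL (Fin 2) (AdeleRing (𝓞 L) L)) : Matrix (Fin 2) (Fin 2) (AdeleRing (𝓞 L) L))‖ₑ :=
    (continuous_testFunction_restrict L hHa hdet hΦ).enorm.measurable
  refine ⟨quotientMeasure (quatRatLatticeOne L Ha) (count : Measure ↥(quatRatLatticeOne L Ha)) (isClosed_quatRatLatticeOne L Ha) dx1 Set.univ * B,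
    ENNReal.mul_ne_top hVt.ne hB, fun t => ?_⟩
  rw [mul_assoc]
  exact lintegral_unitsOne_le_covol_mul L Ha dx1 K hK hφ
    (quatModuleSection L Ha (Units.mk0 (Real.toNNReal (Real.exp t)) (Real.toNNReal_pos.2 (Real.exp_pos t)).ne')) (fun y hy => hb y hy t)

/-- **`y ↦ Φ(y θ_{e^t})` IS `dx¹`-INTEGRABLE ON `D^{(1)}_{h,𝔸}` for every real `t`** (`h` anisotropic, `Φ ∈ 𝒮`): continuous, and `∫⁻ ‖·‖ₑ < ∞` by `lintegral_inner_enorm_le_exp` — the organ licensing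
R4's Bochner unfoldings over `Γ_h`. [cite: WeilBNT1967, Ch. VII §5 Prop. 11] [cite: VignerasLNM800, Ch. III §2 Thm. 2.2] -/
theorem integrable_inner (hanis : ∀ x : Fin 2 → L, hermForm (cmConjRingHom L) Ha x x = 0 → x = 0)
    (dx1 : Measure ↥(quatAdelicUnitsOne L Ha)) [dx1.IsHaarMeasure] [dx1.IsMulRightInvariant]
    [(count : Measure ↥(quatRatLatticeOne L Ha)).IsHaarMeasure]
    {Φ : Matrix (Fin 2) (Fin 2) (AdeleRing (𝓞 L) L) → ℂ}
    (hΦ : Φ ∈ quatSchwartzBruhat L (fun i => ((quatBasis L Ha hHa hdet i : ↥(quatRatSubalgebra L Ha)) : Matrix (Fin 2) (Fin 2) L))) (t : ℝ) :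
    Integrable (fun y : ↥(quatAdelicUnitsOne L Ha) => Φ ((((y : ↥(quatAdelicUnits L Ha)) *
        quatModuleSection L Ha (Units.mk0 (Real.toNNReal (Real.exp t)) (Real.toNNReal_pos.2 (Real.exp_pos t)).ne') : ↥(quatAdelicUnits L Ha)) :
          GL (Fin 2) (AdeleRing (𝓞 L) L)) : Matrix (Fin 2) (Fin 2) (AdeleRing (𝓞 L) L))) dx1 := by
  obtain ⟨B, hB, hle⟩ := lintegral_inner_enorm_le_exp L hHa hdet hanis dx1 hΦ
  refine ⟨((continuous_testFunction_restrict L hHa hdet hΦ).comp (continuous_subtype_val.mul continuous_const)).aestronglyMeasurable, ?_⟩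
  exact lt_of_le_of_lt (hle t) (ENNReal.mul_lt_top hB.lt_top ENNReal.ofReal_lt_top)

end Core

end Summit.HodgeConjecture.HodgeConjecture.Cruxes.H413.K2E5QuatZetaPlusBound

end
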